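import Mathlib.Data.Nat.Choose.Central
import Mathlib.Algebra.BigOperators.Group.Finset.Basic
import Mathlib.Tactic
import Literature.NumberTheory.Irrationality.BrownZudilin2022.TotallySymmetric
import HarnessLib

/-!
# ζ(5) search — CONJECTURE D-exact on the diagonal: the double-sum form of the dual constant term and its
reduction to ONE single-sum identity (fam-tele g10; typed statement + kernel assembly, STAGED — not filed)

HONEST FRAMING: systematic search; no irrationality claim unless certified.  Identities between finite binomial sums
of natural numbers; nothing about the arithmetic of ζ(5); no record moves.  Evidence / pen-and-paper proofs:
`HOME/pub-zeta5-fam-tele/g10/DEXACT-DIAGONAL-PROOF.md` (seat fam-tele g10).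

* `Fdiag n` — the DOUBLE binomial sum `Σ_{k₁+k₂≤n} C(n,k₁)C(n+k₁,n)²·C(n,k₂)C(n+k₁,n−k₂)C(2n−k₂,n)C(2n−k₂,n−k₁−k₂)`
  which the MOS20-style expansion (binomial theorem ×2, coefficient extraction ×5) shows to be the dual constant
  term `dualConstantTerm (n,…,n)` (Theorem 1 of the evidence file; that equality is NOT typed here — it belongs with
  cert-2's `DualCT.coeff_dualSpanProd` machinery);
* `SA`, `SB` — the two inner single sums; `SingleSumIdentity` — `C(n+k,n)·SA n k = C(n,k)·SB n k` (0 ≤ k ≤ n), which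
  follows on paper from Whipple's transformation of terminating balanced ₄F₃(1) series [Andrews–Askey–Roy, Thm 3.3.3]
  and is the natural target of a SINGLE-sum telescoping certificate;
* PROVED here (kernel): `Fdiag_eq_of_singleSum` — `SingleSumIdentity → ∀ n, Fdiag n = Q n` (termwise in `k₁`), and the
  decided instances `Fdiag n = Q n` (`n ≤ 3`), `SingleSumIdentity` for `n ≤ 4`.
Standard axioms only.
-/

namespace Summit.KontsevichZagierPeriods.Zeta5Search.DexactDiagonalWhipple

open Finset
open Literature.NumberTheory.Irrationality.BrownZudilin2022 (Q)

/-- Inner sum of the double-sum form of the dual constant term at outer index `k`: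
`SA n k = Σ_{j=0}^{n−k} C(n,j)·C(n+k,n−j)·C(2n−j,n)·C(2n−j,n−k−j)`. -/
def SA (n k : ℕ) : ℕ :=
  ∑ j ∈ range (n - k + 1), n.choose j * (n + k).choose (n - j) * (2 * n - j).choose n * (2 * n - j).choose (n - k - j)

/-- Inner sum of Brown–Zudilin's (7) at outer index `k`: `SB n k = Σ_{j=0}^{n} C(n+j,n)·C(n,j)²·C(n+k+j,n)`. -/
def SB (n k : ℕ) : ℕ :=
  ∑ j ∈ range (n + 1), (n + j).choose n * n.choose j ^ 2 * (n + k + j).choose n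

/-- **The double-sum form of the dual constant term on the diagonal** (evidence file, eq. (2.2)), written with its
inner sum factored: `Fdiag n = Σ_{k=0}^{n} C(n,k)·C(n+k,n)²·SA n k`. -/
def Fdiag (n : ℕ) : ℕ :=
  ∑ k ∈ range (n + 1), n.choose k * (n + k).choose n ^ 2 * SA n k

/-- **The single-sum identity** `C(n+k,n)·SA(n,k) = C(n,k)·SB(n,k)` for `0 ≤ k ≤ n` (evidence file, (3.4); on paper:
Whipple's ₄F₃ transformation with `(m;a,b,c;d,e,f) = (n;−n,n+1,n+k+1;k+1,1,1)` plus `C(n+k,n)C(2n,n−k) = C(n,k)C(2n,n)`). -/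
def SingleSumIdentity : Prop :=
  ∀ n k : ℕ, k ≤ n → (n + k).choose n * SA n k = n.choose k * SB n k

/-- Brown–Zudilin's `Q n` with its inner sum factored out. -/
theorem Q_eq_sum_SB (n : ℕ) : Q n = ∑ k ∈ range (n + 1), (n + k).choose n * n.choose k ^ 2 * SB n k := by
  unfold Q SB
  refine Finset.sum_congr rfl (fun k _ => ?_)
  rw [Finset.mul_sum]

/-- **Kernel assembly (route K1):** the single-sum identity implies `Fdiag n = Q n` for every `n`, termwise in the
outer index. -/
theorem Fdiag_eq_of_singleSum (h : SingleSumIdentity) (n : ℕ) : Fdiag n = Q n := by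
  rw [Q_eq_sum_SB]
  unfold Fdiag
  refine Finset.sum_congr rfl (fun k hk => ?_)
  have hkn : k ≤ n := Nat.lt_succ_iff.mp (Finset.mem_range.mp hk)
  have H := h n k hkn
  calc n.choose k * (n + k).choose n ^ 2 * SA n k
      = n.choose k * (n + k).choose n * ((n + k).choose n * SA n k) := by ring
    _ = n.choose k * (n + k).choose n * (n.choose k * SB n k) := by rw [H]
    _ = (n + k).choose n * n.choose k ^ 2 * SB n k := by ring

/-- Decided instances of the diagonal identity: `Fdiag n = Q n` for `n = 0, 1, 2, 3` (`1, 21, 2989, 714549`). -/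
theorem Fdiag_eq_Q_le_three : Fdiag 0 = Q 0 ∧ Fdiag 1 = Q 1 ∧ Fdiag 2 = Q 2 ∧ Fdiag 3 = Q 3 := by
  decide

/-- Decided instances of the single-sum identity: all `0 ≤ k ≤ n ≤ 4`. -/
theorem singleSumIdentity_le_four : ∀ n ≤ 4, ∀ k ≤ n, (n + k).choose n * SA n k = n.choose k * SB n k := by
  decide

end Summit.KontsevichZagierPeriods.Zeta5Search.DexactDiagonalWhipple
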